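import Mathlib
import Summits.Ventures.PercRepro2.Defs
import Summits.Ventures.PercRepro2.Graph
import Summits.Ventures.PercRepro2.OneColourSwitch
import Summits.Ventures.PercRepro2.RegionHubSign
import Summits.Ventures.PercRepro2.SideSwitch
import Summits.Ventures.PercRepro2.TermSwitchDefs
import Summits.Ventures.PercRepro2.TermSwitchReach
import Summits.Ventures.PercRepro2.M9NoPocketDefs
import Summits.Ventures.PercRepro2.M9Unreached
import Summits.Ventures.PercRepro2.M9GeneralDSplit
import Summits.Ventures.PercRepro2.M9PsiOneDefs
import Summits.Ventures.PercRepro2.M9PsiOneWorlds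
import Summits.Ventures.PercRepro2.M9PsiOneWorldsM
import Summits.Ventures.PercRepro2.M9PsiOneSurvive
import Summits.Ventures.PercRepro2.M9PsiOneLink
import Summits.Ventures.PercRepro2.M9PsiOneInj
import Summits.Ventures.PercRepro2.M9PsiOneDirty
import Summits.Ventures.PercRepro2.M9PsiTwoDefs
import Summits.Ventures.PercRepro2.M9PsiTwoWorlds
import Summits.Ventures.PercRepro2.M9PsiTwoNoLink
import Summits.Ventures.PercRepro2.M9PsiTwoLink
import Summits.Ventures.PercRepro2.M9PsiTwoSigma
import Summits.Ventures.PercRepro2.M9PsiTwoDirty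

/-!
# The partner `Ψ₁ ω` is ALWAYS a hub–dead-end point (blind cell PercRepro2, p3 g34,
2026-08-29; `proofs/P3-REST2.md` §7, a corollary for THEOREM Ψ₁)

`HD_psiOne` (g31) asks for a `W`-core neighbour of `d` joined to `{r, s}` inside its block;
`exists_rooted_nbr_any` (`M9PsiTwoDirty`) produces one from `d ∈ M₂(ω)` alone.  So every
doubly-reached colouring has a partner in `HD` with `d ∈ K₂ ∖ M₂` (`HD_psiOne_of_isEX`,
`psiOne_mem_HDK`) — the caveat of claim (v) of `P3-PAYMENT.md` §2 is void.  Own work; std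
axioms.
-/

namespace Summit.Ventures.PercRepro2

namespace NoPocket

open Finset Classical RegionHub OneColourSwitch SideSwitch TermSwitch

variable {V : Type*} {E : Type*}

section HDOne

variable {ends : E → Sym2 V} {p q r s d : V} {ω : Config E}

variable (h : IsEX ends p q r s d ω)
include h

/-- **`Ψ₁ ω ∈ HD`** for every doubly-reached colouring (no edge `r–s`). -/
theorem HD_psiOne_of_isEX (hrs : ∀ e, ends e ≠ s(r, s)) :
    HD ends p q r s d (psiOne ends r s d ω) := by
  obtain ⟨x, e, hx, hends, _⟩ := exists_rooted_nbr_any h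
  rcases hx with hx | hx
  · exact HD_psiOne h hrs hx.1 (ends_swap hends) (Or.inl rfl) hx.2
  · exact HD_psiOne h hrs hx.1 (ends_swap hends) (Or.inr rfl) hx.2

/-- **`Ψ₁ ω` is a dirty one-sided `K`-point**: `HD` with `d ∈ K₂ ∖ M₂` (no edge `r–s`). -/
theorem psiOne_mem_HDK (hrs : ∀ e, ends e ≠ s(r, s)) :
    HD ends p q r s d (psiOne ends r s d ω) ∧ d ∈ K2 ends r s (psiOne ends r s d ω) ∧
      d ∉ M2 ends r s (psiOne ends r s d ω) :=
  ⟨HD_psiOne_of_isEX h hrs, mem_K2_psiOne h, not_mem_M2_psiOne h⟩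

end HDOne

end NoPocket

end Summit.Ventures.PercRepro2
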